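import Summits.ResolutionOfSingularities.ResolutionOfSingularities.Theorems.FrobeniusClosingSteerWords20DerivationCurrency
import Summits.ResolutionOfSingularities.ResolutionOfSingularities.Theorems.FrobeniusClosingSteerPointTailChain
import Summits.ResolutionOfSingularities.ResolutionOfSingularities.Theorems.FrobeniusClosingSteerMembersPerfectResidue
import Summits.ResolutionOfSingularities.ResolutionOfSingularities.Theorems.FrobeniusClosingSteerMemberDerivationsEFT

/-!
# Crux `Steer` (stmt-ResolutionOfSingularities-16345), line `switching-dichotomy` — WORDS 22: §σ2.26 F-B OVER THE RUN (the fork F-B♮ `StrippingTailIsolatedConclTwoN` / F-B-wild `StrippingTailWildConclTwoN`, Θ♮ `PointTailChainTwoN`, `strippingTailHighConclTwoN_of_pieces`) and res-D-pv-011's Θ♮ packaging leaves `pointTailChainTwoN_of_L7_of_recur` / `pointTailChainTwoN_of_recur` (p528265 / p528709) (HOIST of the registered skeleton r49 bb092f8f650aca19, l.1699–1961, inside `section HeightSplitTwo` with its `variable {K : Type} [Field K]`)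

Holder res-L0-w41-lead-1 g6 on res-L0-w41-plan-1 RULING 47 (E1) / 104b; see `…Words01Core` for the hoist protocol (bodies byte for byte;
`[cite: …]` / `[folklore]` tags on CLOSED `def … : Prop` words are written «(ref. …)» / «(folklore)» — GATE NOTE of `…Words02Stubs`;
cite keys inside `[cite:]` tags normalised to `references.bib` keys where needed, as in `…Words03Phases`).
Nothing here is a statement of the manuscript [claim: Hironaka2017, status: under-review]. OURS (candidates / vocabulary; AI review is
weaker than expert review).
-/

open Summit.ResolutionOfSingularities.ResolutionOfSingularities.Theses.FrobeniusClosing (IsolatedForcedTermination)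
open Literature.AlgebraicGeometry.Resolution (IsAbhyankarPlace FGOver exists_ringKrullDim_eq_and_trdeg_eq
  trdeg_eq_trdeg_of_isFractionRing locAtCentre IsQuadraticTransformAlong SubringDominates IsRsopPart
  LocalUniformization3 RelLocalUniformization CossartPiltant2019General)
open Summit.ResolutionOfSingularities.ResolutionOfSingularities.Theorems.SteerRankThinness
  (HasProperCoarsening concl_of_hasProperCoarsening rankOne_of_not_hasProperCoarsening)
open Summit.ResolutionOfSingularities.ResolutionOfSingularities.Theorems.PfaffLine

set_option linter.dupNamespace false

namespace Summit.ResolutionOfSingularities.ResolutionOfSingularities.Theorems.SwitchingDichotomy.Words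

section SteeredTwo

open IsLocalRing
open Literature.AlgebraicGeometry.Resolution (IsLocalBlowupAlong IsQuadraticTransform IsExcellentRing)

variable {K : Type} [Field K]


/-! ##### F-B over the RUN (was §σ2.26b; plan-1 RULINGS 73b (ii) / 76a / 78 / 86b; tri-1 v6.9 SOUND): the fork isolated/wild, the packaging Θ♮ into
the PERFECT chain, the assembly `_of_pieces` -/

/-- **F-B♮ · StrippingTailIsolatedConclTwoN** (F-B's binders VERBATIM + «from some stage on, at every POINT-STEP stage `i` the torsor
`R i[s i]`, `(s i)^p ∈ R i`, has an isolated singularity» ⇒ `Concl`): the (E) ∩ isolated residual of F-B (RULING 76a). Reduced below to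
Θ♮ packaging ∧ K♭ v2.2-perfect (4). OURS. (folklore) -/
def StrippingTailIsolatedConclTwoN : Prop :=
  ∀ p : ℕ, p = 2 →
    ∀ (k K : Type) [Field k] [CharP k p] [PerfectField k] [Field K] [Algebra k K]
    (O : ValuationSubring K) (A₀ : Subalgebra k K) (h₀ : A₀.toSubring ≤ O.toSubring) (t : K),
    CoreDatum p 4 k K O A₀ h₀ t → ¬ HasProperCoarsening O →
    ∀ (R : ℕ → Subring K) (P : (i : ℕ) → Ideal (R i)) (s : ℕ → K),
      R 0 = locAtCentre A₀.toSubring O → NormalAt O (R 0) p t → IsSteeredRun O R P t p s →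
      (¬ ∃ i₀ c : ℕ, 1 ≤ c ∧ IsDominantTail R P i₀ c) →
      (∃ i₀ : ℕ, ∀ i, i₀ ≤ i → IsHighOrderAt R s p i) →
      ¬ HeightTwoStepsInfinite R P → {j | IsPosStep R P j}.Infinite →
      (∃ i₀ : ℕ, ∀ i, i₀ ≤ i → IsPointStep R P i →
        ∃ hs : s i ^ p ∈ R i, HasIsolatedSingularity (RadicandRing (R i) p ⟨s i ^ p, hs⟩)) →
      Concl O A₀ t

/-- **F-B-wild · StrippingTailWildConclTwoN** (FRONTIER research object, RULING 76a (Par)/(Iso); res-L0-w41-tri-1 D·S4/D·S5, idea-1 card 7):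
F-B's binders VERBATIM + «infinitely many point-step stages carry a NON-isolated torsor» (after an ODD fully-stripped divisor the member is
`h² + x·G`, singular along every minimal prime over `(x, G)`; σ_top then forks: smooth factor ⇒ a height-2 centre — finitely often under F-B —
or a point step at a non-isolated stage, which is this piece) ⇒ `Concl`. No invariant on record. OURS. (folklore) -/
def StrippingTailWildConclTwoN : Prop :=
  ∀ p : ℕ, p = 2 →
    ∀ (k K : Type) [Field k] [CharP k p] [PerfectField k] [Field K] [Algebra k K]
    (O : ValuationSubring K) (A₀ : Subalgebra k K) (h₀ : A₀.toSubring ≤ O.toSubring) (t : K),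
    CoreDatum p 4 k K O A₀ h₀ t → ¬ HasProperCoarsening O →
    ∀ (R : ℕ → Subring K) (P : (i : ℕ) → Ideal (R i)) (s : ℕ → K),
      R 0 = locAtCentre A₀.toSubring O → NormalAt O (R 0) p t → IsSteeredRun O R P t p s →
      (¬ ∃ i₀ c : ℕ, 1 ≤ c ∧ IsDominantTail R P i₀ c) →
      (∃ i₀ : ℕ, ∀ i, i₀ ≤ i → IsHighOrderAt R s p i) →
      ¬ HeightTwoStepsInfinite R P → {j | IsPosStep R P j}.Infinite →
      (∀ i₀ : ℕ, ∃ i, i₀ ≤ i ∧ IsPointStep R P i ∧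
        ∀ hs : s i ^ p ∈ R i, ¬ HasIsolatedSingularity (RadicandRing (R i) p ⟨s i ^ p, hs⟩)) →
      Concl O A₀ t

/-- F-B ⟸ F-B♮ ∧ F-B-wild (pure logic: the point-step stages are eventually all isolated or not). OURS. [folklore] -/
theorem strippingTailHighConclTwoN_of_fork (hI : StrippingTailIsolatedConclTwoN) (hW : StrippingTailWildConclTwoN) :
    StrippingTailHighConclTwoN := by
  intro p hp k K _ _ _ _ _ O A₀ h₀ t hcore hnc R P s hR0 hN hrun hndom hhigh hfin hinf
  by_cases h : ∃ i₀ : ℕ, ∀ i, i₀ ≤ i → IsPointStep R P i →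
      ∃ hs : s i ^ p ∈ R i, HasIsolatedSingularity (RadicandRing (R i) p ⟨s i ^ p, hs⟩)
  · exact hI p hp k K O A₀ h₀ t hcore hnc R P s hR0 hN hrun hndom hhigh hfin hinf h
  · push Not at h
    exact hW p hp k K O A₀ h₀ t hcore hnc R P s hR0 hN hrun hndom hhigh hfin hinf h

/-- **Θ♮ · PointTailChainTwoN** (SUPPORT, provable PACKAGING — F-B♮'s binders + K♭ v2.2-perfect (4) at the run's `p` ⇒ `Concl`, vacuously: the tail cannot
exist): member germs `S m := R (i m)` at the point-step stages `i₀ ≤ i 0 < i 1 < …` of the tail (regular local, excellent, dimension 4 by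
`CoreDatum`: `trdeg = 4`, `ZeroDim`), `f m := (s (i m))^p` (HIGH ⇒ multiplicity `p`), `x m` := the exceptional parameter of the point step,
`e m := 1 + #strippings between i m and i (m+1)` (so `hinf` ⟸ «height-1 positive steps infinitely often» ⟸ F-B's last two binders), law from
`IsSteeredRun`'s step relations (the strips are identity on the base, res-D-pv-003's (L1); cleaner location per (L2) CLEANER DESCENT,
res-L0-w41-stub-4), isolatedness from F-B♮'s clause; one level SIMPLER than Θ1♭ `StrippedThreadTwoN` (no localisation at thread primes).
OURS. (folklore) -/
def PointTailChainTwoN : Prop :=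
  ∀ p : ℕ, p = 2 →
    ∀ (k K : Type) [Field k] [CharP k p] [PerfectField k] [Field K] [Algebra k K]
    (O : ValuationSubring K) (A₀ : Subalgebra k K) (h₀ : A₀.toSubring ≤ O.toSubring) (t : K),
    CoreDatum p 4 k K O A₀ h₀ t → ¬ HasProperCoarsening O →
    ∀ (R : ℕ → Subring K) (P : (i : ℕ) → Ideal (R i)) (s : ℕ → K),
      R 0 = locAtCentre A₀.toSubring O → NormalAt O (R 0) p t → IsSteeredRun O R P t p s →
      (¬ ∃ i₀ c : ℕ, 1 ≤ c ∧ IsDominantTail R P i₀ c) →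
      (∃ i₀ : ℕ, ∀ i, i₀ ≤ i → IsHighOrderAt R s p i) →
      ¬ HeightTwoStepsInfinite R P → {j | IsPosStep R P j}.Infinite →
      (∃ i₀ : ℕ, ∀ i, i₀ ≤ i → IsPointStep R P i →
        ∃ hs : s i ^ p ∈ R i, HasIsolatedSingularity (RadicandRing (R i) p ⟨s i ^ p, hs⟩)) →
      NoEternalStrippedRadicandChainHP p 4 →
      Concl O A₀ t

/-! #### §σ2.26 F-B♮ — Θ♮ `PointTailChainTwoN` MODULO (L7) and (Σ) «point steps recur» (adoption leaf, res-D-pv-011 AS res-L0-w41-stub-7;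
res-L0-w41-plan-1 RULING 100)

INSERTION RECIPE (holder only): (i) add the two imports
`import Summits.ResolutionOfSingularities.ResolutionOfSingularities.Theorems.FrobeniusClosingSteerPointTailChain` and
`import Summits.ResolutionOfSingularities.ResolutionOfSingularities.Theorems.FrobeniusClosingSteerMembersPerfectResidue`; (ii) paste this
block right before `eternalSteeredRunTwo_of_slate7`. New name only: `pointTailChainTwoN_of_L7_of_recur`. 0 sorries in this block.
Tree files (ACCEPTED, `--supports 16345 --as helper`, Theses-free): p526785 `…StrippedThreadChainExists` (Θ1♭ engine, existential form) ·
p527601 `…StrippedThreadChainExistsH` (K♭H / K♭HP body refutations) · `…PointTailChain` (Θ♮ engine `PointTail.not_noEternalStrippedChainHP_of_pointTail`);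
with res-D-pv-003's engine (p524822), res-L0-w41-stub-4's (L2) `CleanerDescent.cleaner_descent`, res-type-096's `GeoDict` bridges,
stub-2's `MembersPerfectResidue.perfectField_residueField_of_steps`, and the CoreDatum plumbing of `strippedThreadTwoNH_of_L7` VERBATIM. -/

/-- **Θ♮ · `PointTailChainTwoN` MODULO (L7) and (Σ)** (adoption leaf). `hL7` = res-D-pv-004's (L7) in res-D-pv-003's binder shape
(`strippedThreadTwoNH_of_L7`, same hypothesis); `hrecur` = (Σ) «POINT STEPS RECUR»: under F-B's binders (normalised start, steered run, no dominant
tail, eventually HIGH, finitely many height-≥2 steps, infinitely many positive steps) there is a point step beyond every stage — true (an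
eternal tail of strips at a fixed member forces the radicand into `R̂^p`, Frobenius-closedness), M-sized, owner res-D-pv-011; kept as an
explicit hypothesis here so that the packaging closes today. Proof: CoreDatum plumbing as in `strippedThreadTwoNH_of_L7`; thresholds; the Θ♮
engine on the trivial thread; H from `hL7` through `GeoDict.essFiniteType_of_locChar` at `Q = 𝔪` (the germ is the member); perfect residue
fields from ZeroDim (`MembersPerfectResidue`). OURS. [folklore] -/
theorem pointTailChainTwoN_of_L7_of_recur
    (hL7 : ∀ {k K : Type} [Field k] [Field K] [Algebra k K] (p : ℕ) [Fact p.Prime] [CharP k p] [PerfectField k]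
      (S : Subring K) [IsRegularLocalRing S] [Algebra k S],
      (∀ c : k, ((algebraMap k S c : S) : K) = algebraMap k K c) → Algebra.EssFiniteType k S →
      ∀ f g : S, HasCleaningDerivations p S f g)
    (hrecur : ∀ p : ℕ, p = 2 →
      ∀ (k K : Type) [Field k] [CharP k p] [PerfectField k] [Field K] [Algebra k K]
      (O : ValuationSubring K) (A₀ : Subalgebra k K) (h₀ : A₀.toSubring ≤ O.toSubring) (t : K),
      CoreDatum p 4 k K O A₀ h₀ t → ¬ HasProperCoarsening O →
      ∀ (R : ℕ → Subring K) (P : (i : ℕ) → Ideal (R i)) (s : ℕ → K),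
        R 0 = locAtCentre A₀.toSubring O → NormalAt O (R 0) p t → IsSteeredRun O R P t p s →
        (¬ ∃ i₀ c : ℕ, 1 ≤ c ∧ IsDominantTail R P i₀ c) →
        (∃ i₀ : ℕ, ∀ i, i₀ ≤ i → IsHighOrderAt R s p i) →
        ¬ HeightTwoStepsInfinite R P → {j | IsPosStep R P j}.Infinite →
        ∀ i₀ : ℕ, ∃ i, i₀ ≤ i ∧ IsPointStep R P i) :
    PointTailChainTwoN := by
  intro p hp2 k K _ _ _ _ _ O A₀ h₀ t core hnc R P s hR0 hN hrun hnd hhigh h2fin hposinf hiso hK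
  have hrec := hrecur p hp2 k K O A₀ h₀ t core hnc R P s hR0 hN hrun hnd hhigh h2fin hposinf
  subst hp2
  haveI : Fact (Nat.Prime 2) := ⟨Nat.prime_two⟩
  haveI : CharP K 2 := charP_of_injective_algebraMap (algebraMap k K).injective 2
  obtain ⟨hfg, htp, hfr, hreg, -, hzd, -, -, -, -, -, -, htr, -⟩ := core
  have hmono : Monotone R := hrun.monotone
  obtain ⟨-, hstep⟩ := hrun
  have hsp : ∀ i, s i ^ 2 ∈ R i := fun i => by
    obtain ⟨_, hs, -⟩ := hstep i
    exact hs
  have hbl : ∀ i, IsLocalBlowupAlong O (R i) (P i) (R (i + 1)) := fun i => by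
    obtain ⟨_, _, -, hbl, -⟩ := hstep i
    exact hbl
  have h0 : IsRegularLocalRing (R 0) := by
    rw [hR0]
    exact (Literature.AlgebraicGeometry.Resolution.isRegularLocalRing_locAtCentre_iff h₀).mpr hreg
  have hregR : ∀ i, IsRegularLocalRing (R i) := fun i =>
    _root_.Summit.ResolutionOfSingularities.ResolutionOfSingularities.Theorems.SwitchingDichotomy.SteeredMembersRegular.isRegularLocalRing_steps (O := O) R P i h0 (fun j _ => by
      obtain ⟨hloc, hs, hσ, hblj, -⟩ := hstep j
      refine ⟨hloc, ?_, hblj⟩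
      rcases hσ with hperm | ⟨hP, -, -⟩
      · exact Or.inl hperm.2.2.1
      · exact Or.inr hP) i le_rfl
  haveI hlocR : ∀ i, IsLocalRing (R i) := fun i => by haveI := hregR i; infer_instance
  have hdim : ∀ i, ringKrullDim (R i) = (4 : ℕ) := fun i =>
    _root_.Summit.ResolutionOfSingularities.ResolutionOfSingularities.Theorems.SwitchingDichotomy.TailCodim.ringKrullDim_member_eq
      k K O A₀ h₀ t two_pos hfg htp hfr hzd htr R i hR0 fun j _ => (hbl j).isLocalBlowup
  -- ### σ-data at the positive steps: prime and singular
  have hvis : ∀ i, (∃ _ : IsLocalRing (R i), P i ≠ IsLocalRing.maximalIdeal (R i)) →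
      (P i).IsPrime ∧
      (∀ _ : (P i).IsPrime, ¬ IsRegularLocalRing (AdjoinRoot ((Polynomial.X : Polynomial (Localization.AtPrime (P i))) ^ 2 -
          Polynomial.C (algebraMap (R i) (Localization.AtPrime (P i)) ⟨s i ^ 2, hsp i⟩)))) := by
    intro i ⟨_, hne⟩
    obtain ⟨hloc, hs, hσ, -, -⟩ := hstep i
    have hperm : IsPermissibleCentre (R i) 2 ⟨s i ^ 2, hsp i⟩ (P i) := by
      rcases hσ with hperm | ⟨hP, -, -⟩
      · exact hperm
      · exact absurd hP hne
    obtain ⟨hPi, hsing, -, -⟩ := hperm.2.1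
    exact ⟨hPi, fun _ => hsing⟩
  -- ### the four tail clauses in the engine's shape
  have hpt : ∀ i₀ : ℕ, ∃ i, i₀ ≤ i ∧ ∃ _ : IsLocalRing (R i), P i = IsLocalRing.maximalIdeal (R i) := by
    intro i₀
    obtain ⟨i, hi, hpt⟩ := hrec i₀
    exact ⟨i, hi, hpt⟩
  have hpos : ∀ i₀ : ℕ, ∃ i, i₀ ≤ i ∧ ∃ _ : IsLocalRing (R i), P i ≠ IsLocalRing.maximalIdeal (R i) := by
    intro i₀
    obtain ⟨i, hi, hi₀⟩ := hposinf.exists_gt i₀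
    exact ⟨i, hi₀.le, hi⟩
  have hfin2 : ∃ m₀ : ℕ, ∀ m, m₀ ≤ m → (∃ _ : IsLocalRing (R m), P m ≠ IsLocalRing.maximalIdeal (R m)) → (P m).height ≤ 1 := by
    have hfin : {j | IsPosStepTwo R P j}.Finite := Set.not_infinite.mp h2fin
    obtain ⟨m₀, hm₀⟩ := hfin.bddAbove
    refine ⟨m₀ + 1, fun m hm hposm => ?_⟩
    by_contra hgt
    have h2 : 2 ≤ (P m).height := by
      rw [not_le] at hgt
      exact Order.add_one_le_of_lt hgt
    have : m ≤ m₀ := hm₀ ⟨hposm, h2⟩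
    omega
  have hmult : ∃ i₀ : ℕ, ∀ i, i₀ ≤ i → (∃ _ : IsLocalRing (R i), P i = IsLocalRing.maximalIdeal (R i)) →
      ∃ g : R i, (⟨s i ^ 2, hsp i⟩ : R i) - g ^ 2 ∈ P i ^ 2 := by
    obtain ⟨i₀, hi₀⟩ := hhigh
    refine ⟨i₀, fun i hi ⟨_, hP⟩ => ?_⟩
    obtain ⟨_, hs, g, hg⟩ := hi₀ i hi
    refine ⟨g, ?_⟩
    rw [hP]
    exact Ideal.pow_le_pow_right (by norm_num) hg
  have hiso' : ∃ i₀ : ℕ, ∀ i, i₀ ≤ i → (∃ _ : IsLocalRing (R i), P i = IsLocalRing.maximalIdeal (R i)) →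
      ∀ (Q : Ideal (AdjoinRoot ((Polynomial.X : Polynomial (R i)) ^ 2 - Polynomial.C (⟨s i ^ 2, hsp i⟩ : R i)))) [Q.IsPrime],
        (∃ Q' : Ideal (AdjoinRoot ((Polynomial.X : Polynomial (R i)) ^ 2 - Polynomial.C (⟨s i ^ 2, hsp i⟩ : R i))),
          Q'.IsPrime ∧ Q < Q') → IsRegularLocalRing (Localization.AtPrime Q) := by
    obtain ⟨i₀, hi₀⟩ := hiso
    refine ⟨i₀, fun i hi hpt Q hQp hQ => ?_⟩
    obtain ⟨hs, hisol⟩ := hi₀ i hi hpt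
    exact hisol Q hQ
  -- ### H for the members, from (L7) through the model (the member is the localisation of a finitely generated `k`-algebra)
  have hH : ∀ (i : ℕ) (T : Subring K) [IsLocalRing T], T = R i → ∀ f g : T,
      (∀ N : ℕ, (∀ h : T, f - h ^ 2 ∉ IsLocalRing.maximalIdeal T ^ (N + 1)) → f - g ^ 2 ∈ IsLocalRing.maximalIdeal T ^ N →
        ∃ D : Derivation ℤ T T, D f ∉ IsLocalRing.maximalIdeal T ^ N ∨
          ((∀ y ∈ IsLocalRing.maximalIdeal T, D y ∈ IsLocalRing.maximalIdeal T) ∧ D f ∉ IsLocalRing.maximalIdeal T ^ (N + 1))) := by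
    intro i T _ hT f g
    subst hT
    obtain ⟨A₁, -, -, hfg₁, hRA₁⟩ :=
      _root_.Summit.ResolutionOfSingularities.ResolutionOfSingularities.Theorems.SwitchingDichotomy.SteeredExit.exists_model_of_tower
        O A₀ h₀ hfg hR0 (N := i) fun l _ => (hbl l).isLocalBlowup
    haveI := hregR i
    -- the member is its own germ at the maximal ideal
    have hS : ∀ z : K, z ∈ R i ↔ ∃ a b : R i, b ∉ IsLocalRing.maximalIdeal (R i) ∧ z = (a : K) / b := by
      intro z
      constructor
      · intro hz
        refine ⟨⟨z, hz⟩, 1, fun h => ?_, by simp⟩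
        exact (IsLocalRing.maximalIdeal.isMaximal (R i)).ne_top (Ideal.eq_top_of_isUnit_mem _ h isUnit_one)
      · rintro ⟨a, b, hb, rfl⟩
        have hbu : IsUnit b := by
          by_contra h
          exact hb ((IsLocalRing.mem_maximalIdeal b).mpr h)
        obtain ⟨-, hbinv⟩ := (Literature.AlgebraicGeometry.Resolution.isUnit_subring_iff_inv_mem b).mp hbu
        rw [div_eq_mul_inv]
        exact (R i).mul_mem a.2 hbinv
    letI : Algebra k (R i) := ((algebraMap k K).codRestrict (R i)
      (_root_.Summit.ResolutionOfSingularities.ResolutionOfSingularities.Theorems.SwitchingDichotomy.GeoDict.algebraMap_mem_of_locChar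
        O A₁ hRA₁ hS)).toAlgebra
    have hcompat : ∀ c : k, ((algebraMap k (R i) c : R i) : K) = algebraMap k K c := fun c => rfl
    have hEFT : Algebra.EssFiniteType k (R i) :=
      _root_.Summit.ResolutionOfSingularities.ResolutionOfSingularities.Theorems.SwitchingDichotomy.GeoDict.essFiniteType_of_locChar
        O A₁ hRA₁ hS hfg₁ hcompat
    exact hL7 2 (R i) hcompat hEFT f g
  -- ### perfect residue fields of the members (ZeroDim + `k` perfect)
  have hperf : ∀ (i : ℕ) (T : Subring K) [IsLocalRing T], T = R i → PerfectField (IsLocalRing.ResidueField T) := by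
    intro i T _ hT
    subst hT
    exact _root_.Summit.ResolutionOfSingularities.ResolutionOfSingularities.Theorems.SwitchingDichotomy.MembersPerfectResidue.perfectField_residueField_of_steps
      O A₀ h₀ hzd R P i hR0 fun l _ => hbl l
  -- ### the Θ♮ engine
  have hne := _root_.Summit.ResolutionOfSingularities.ResolutionOfSingularities.Theorems.SwitchingDichotomy.PointTail.not_noEternalStrippedChainHP_of_pointTail
    2 O A₀ h₀ hfg R P s 4 hR0 hbl (fun i => by obtain ⟨_, _, -, -, hst⟩ := hstep i; exact hst) hsp hregR hdim
    hvis hpt hpos hfin2 hmult hiso'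
    (fun S S' _ _ hle hqt ξ hξ hspan f G F hf hG hF e he hlaw =>
      _root_.Summit.ResolutionOfSingularities.ResolutionOfSingularities.Theorems.SwitchingDichotomy.CleanerDescent.cleaner_descent
        2 hle hqt hξ hspan hf hG hF he hlaw)
    hH hperf
  exact (hne hK).elim



/-- **Θ♮ · `PointTailChainTwoN` MODULO (Σ) ONLY** — the (L7) binder discharged by res-D-pv-004's
`MemberDerivations.hasCleaningDerivations_of_essFiniteType_perfect` (p526306/p526976/p528709; the skeleton word `HasCleaningDerivations` and
the tree's are byte-identical, so the bodies agree by unfolding). Needs `import …Theorems.FrobeniusClosingSteerMemberDerivationsEFT`. OURS. [folklore] -/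
theorem pointTailChainTwoN_of_recur
    (hrecur : ∀ p : ℕ, p = 2 →
      ∀ (k K : Type) [Field k] [CharP k p] [PerfectField k] [Field K] [Algebra k K]
      (O : ValuationSubring K) (A₀ : Subalgebra k K) (h₀ : A₀.toSubring ≤ O.toSubring) (t : K),
      CoreDatum p 4 k K O A₀ h₀ t → ¬ HasProperCoarsening O →
      ∀ (R : ℕ → Subring K) (P : (i : ℕ) → Ideal (R i)) (s : ℕ → K),
        R 0 = locAtCentre A₀.toSubring O → NormalAt O (R 0) p t → IsSteeredRun O R P t p s →
        (¬ ∃ i₀ c : ℕ, 1 ≤ c ∧ IsDominantTail R P i₀ c) →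
        (∃ i₀ : ℕ, ∀ i, i₀ ≤ i → IsHighOrderAt R s p i) →
        ¬ HeightTwoStepsInfinite R P → {j | IsPosStep R P j}.Infinite →
        ∀ i₀ : ℕ, ∃ i, i₀ ≤ i ∧ IsPointStep R P i) :
    PointTailChainTwoN :=
  pointTailChainTwoN_of_L7_of_recur
    (fun p _ _ _ S _ _ hc hE f g => by
      haveI := hE
      have h := _root_.Summit.ResolutionOfSingularities.ResolutionOfSingularities.Theorems.SwitchingDichotomy.MemberDerivations.hasCleaningDerivations_of_essFiniteType_perfect
        p S hc f g
      unfold _root_.Summit.ResolutionOfSingularities.ResolutionOfSingularities.Theorems.SwitchingDichotomy.MemberDerivations.HasCleaningDerivations at h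
      unfold HasCleaningDerivations
      exact h)
    hrecur


/-- F-B♮ ⟸ Θ♮ ∧ K♭ v2.2-perfect (4). Pure logic. OURS. [folklore] -/
theorem strippingTailIsolatedConclTwoN_of_chain (hΘ : PointTailChainTwoN)
    (hK4 : ∀ p : ℕ, p.Prime → NoEternalStrippedRadicandChainHP p 4) : StrippingTailIsolatedConclTwoN := by
  intro p hp2 k K _ _ _ _ _ O A₀ h₀ t core hrk R P s hR0 hN hrun hnd hhigh h2 hinf hiso
  exact hΘ p hp2 k K O A₀ h₀ t core hrk R P s hR0 hN hrun hnd hhigh h2 hinf hiso (hK4 p (hp2 ▸ Nat.prime_two))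

end SteeredTwo

end Summit.ResolutionOfSingularities.ResolutionOfSingularities.Theorems.SwitchingDichotomy.Words
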